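import Summits.ValiantsHypothesis.ValiantsHypothesis.Theorems.FeketeSOSFeketeSOSHardPaleyRIPFlatLevelSets
import Mathlib.Analysis.Complex.Basic

/-!
# Route FeketeSOS — crux `FeketeSOSHard` (stmt-ValiantsHypothesis-3996), line `paley-rip`,
# stub `stub_paleyFlatRIP`: FLAT bounds imply GENERAL-weight bounds (the flat-RIP lemma)

A matrix-generic inequality (no number theory), used by `…PaleyRIPFlatOfDiscrepancy.lean` to reduce the
engine `stub_paleyFlatRIP` (a bound for the Paley–Hankel quadratic form over ALL complex weight vectors
on a sparse support) to FLAT (0/1-weight) restricted discrepancy.  It is the mechanism of the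
"flat RIP ⇒ RIP" lemma of Bourgain–Dilworth–Ford–Konyagin–Kutzarova (Duke Math. J. 159 (2011), §3) and
of the "flat restricted orthogonality" lemma of Bandeira–Fickus–Mixon–Wong (J. Fourier Anal. Appl. 19
(2013), Thm 13), in the principal-block / quadratic-form format of the line, with explicit (unoptimised)
constants:

> Let `S` be a finite set, `M : S × S → ℝ` with `|M_{ab}| ≤ 1`, `θ ≥ 0`, and suppose the FLAT bound
> `|Σ_{a∈A,b∈B} M_{ab}| ≤ θ √#A √#B` holds for all `A, B ⊆ S`.  Then for every `w : S → ℂ`,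
> `|Σ_{a,b∈S} M_{ab} w_a w_b| ≤ (16θ(2 log₂#S + 2) + 8) · Σ_{a∈S} |w_a|²`
> (`norm_cplxForm_le_of_flat`; `log₂` is `Nat.log 2`).

Proof (dyadic level sets, tools in `…PaleyRIPFlatLevelSets.lean`).  For `u, v ≥ 0`
(`abs_bilin_le_of_flat_nonneg`): split the values of `u` into the classes
`C_j = {‖u‖/2^{j+1} < u ≤ ‖u‖/2^j}`, `j < J = 2 log₂#S + 2`, and the remainder `{u ≤ ‖u‖/2^J}`; on
`C_j × D_k` the weights are flat up to factors in `[0,1]`, so the box lemma and the flat hypothesis give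
`θ (‖u‖/2^j)(‖v‖/2^k) √#C_j √#D_k`, and Cauchy–Schwarz over classes costs `4J`; the remainder is bounded
trivially via `#S² ≤ 2^J`.  Signs (`abs_bilin_le_of_flat_real`) and real/imaginary parts
(`norm_cplxForm_le_of_flat`) cost the factors `2` and `4`.

Honest framing: a known lemma re-proved in the tree's format as a tool; by itself it says nothing about
the Paley matrix, the crux `FeketeSOSHard`, or `VP ≠ VNP`.
-/

-- the line's namespace repeats a path segment by convention (same as the other paley-rip files)
set_option linter.dupNamespace false

namespace Summit.ValiantsHypothesis.ValiantsHypothesis.Theorems.FeketeSOSHardPaleyRIP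

open Finset
open scoped BigOperators

noncomputable section

section FlatToGeneral

variable {ι : Type*}

/-- **Flat ⇒ general, nonnegative weights.** With `|M| ≤ 1`, `θ ≥ 0` and the flat bound on all
`A, B ⊆ S`: for `u, v ≥ 0` on `S`,
`|Σ_{a,b∈S} M_{ab} u_a v_b| ≤ (4θ(2·log₂#S + 2) + 2) ‖u‖₂ ‖v‖₂` (`log₂ = Nat.log 2`). [folklore] -/
theorem abs_bilin_le_of_flat_nonneg (S : Finset ι) (M : ι → ι → ℝ) (hM : ∀ a b, |M a b| ≤ 1)
    (θ : ℝ) (hθ : 0 ≤ θ)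
    (hflat : ∀ A ⊆ S, ∀ B ⊆ S,
      |∑ a ∈ A, ∑ b ∈ B, M a b| ≤ θ * (Real.sqrt A.card * Real.sqrt B.card))
    (u v : ι → ℝ) (hu : ∀ a ∈ S, 0 ≤ u a) (hv : ∀ b ∈ S, 0 ≤ v b) :
    |∑ a ∈ S, ∑ b ∈ S, M a b * u a * v b| ≤
      (4 * θ * (2 * Nat.log 2 S.card + 2) + 2) *
        (Real.sqrt (∑ a ∈ S, u a ^ 2) * Real.sqrt (∑ b ∈ S, v b ^ 2)) := by
  classical
  set Nu : ℝ := Real.sqrt (∑ a ∈ S, u a ^ 2) with hNu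
  set Nv : ℝ := Real.sqrt (∑ b ∈ S, v b ^ 2) with hNv
  have hNu0 : 0 ≤ Nu := Real.sqrt_nonneg _
  have hNv0 : 0 ≤ Nv := Real.sqrt_nonneg _
  have hΛ0 : 0 ≤ 4 * θ * (2 * Nat.log 2 S.card + 2) + 2 := by positivity
  -- degenerate cases
  by_cases hu0 : ∑ a ∈ S, u a ^ 2 = 0
  · have hz : ∑ a ∈ S, ∑ b ∈ S, M a b * u a * v b = 0 :=
      sum_eq_zero fun a ha => sum_eq_zero fun b _ => by
        rw [eq_zero_of_sum_sq_eq_zero S u hu0 ha]; ring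
    rw [hz, abs_zero]; positivity
  by_cases hv0 : ∑ b ∈ S, v b ^ 2 = 0
  · have hz : ∑ a ∈ S, ∑ b ∈ S, M a b * u a * v b = 0 :=
      sum_eq_zero fun a _ => sum_eq_zero fun b hb => by
        rw [eq_zero_of_sum_sq_eq_zero S v hv0 hb]; ring
    rw [hz, abs_zero]; positivity
  have hNupos : 0 < Nu := Real.sqrt_pos.2 (lt_of_le_of_ne (sum_nonneg fun a _ => sq_nonneg _) (Ne.symm hu0))
  have hNvpos : 0 < Nv := Real.sqrt_pos.2 (lt_of_le_of_ne (sum_nonneg fun a _ => sq_nonneg _) (Ne.symm hv0))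
  have hule : ∀ a ∈ S, u a ≤ Nu := fun a ha => le_sqrt_sum_sq S u hu ha
  have hvle : ∀ b ∈ S, v b ≤ Nv := fun b hb => le_sqrt_sum_sq S v hv hb
  -- the number of dyadic classes
  set K : ℕ := S.card with hK
  set J : ℕ := 2 * Nat.log 2 K + 2 with hJ
  have hKJ : ((K : ℝ) ^ 2) ≤ 2 ^ J := by
    have h1 : K < 2 ^ (Nat.log 2 K + 1) := Nat.lt_pow_succ_log_self (by norm_num) K
    have h2 : K ^ 2 ≤ (2 ^ (Nat.log 2 K + 1)) ^ 2 := Nat.pow_le_pow_left h1.le 2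
    have h3 : (2 ^ (Nat.log 2 K + 1)) ^ 2 = 2 ^ J := by rw [← pow_mul, hJ]; ring_nf
    exact_mod_cast h3 ▸ h2
  have h2J : (0 : ℝ) < 2 ^ J := by positivity
  -- remainder / high parts
  set Ru := S.filter (fun a => u a ≤ Nu / 2 ^ J) with hRu
  set Hu := S.filter (fun a => Nu / 2 ^ J < u a) with hHu
  set Rv := S.filter (fun b => v b ≤ Nv / 2 ^ J) with hRv
  set Hv := S.filter (fun b => Nv / 2 ^ J < v b) with hHv
  have hsplit_u : ∀ g : ι → ℝ, ∑ a ∈ S, g a = ∑ a ∈ Ru, g a + ∑ a ∈ Hu, g a := by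
    intro g
    rw [hRu, hHu, ← sum_filter_add_sum_filter_not S (fun a => u a ≤ Nu / 2 ^ J) g]
    congr 1
    exact sum_congr (filter_congr fun a _ => not_le) fun _ _ => rfl
  have hsplit_v : ∀ g : ι → ℝ, ∑ b ∈ S, g b = ∑ b ∈ Rv, g b + ∑ b ∈ Hv, g b := by
    intro g
    rw [hRv, hHv, ← sum_filter_add_sum_filter_not S (fun b => v b ≤ Nv / 2 ^ J) g]
    congr 1
    exact sum_congr (filter_congr fun b _ => not_le) fun _ _ => rfl
  -- crude sums
  have hsum_u : ∑ a ∈ S, u a ≤ K * Nu := by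
    calc ∑ a ∈ S, u a ≤ ∑ a ∈ S, Nu := sum_le_sum hule
      _ = K * Nu := by rw [sum_const, nsmul_eq_mul]
  have hsum_v : ∑ b ∈ S, v b ≤ K * Nv := by
    calc ∑ b ∈ S, v b ≤ ∑ b ∈ S, Nv := sum_le_sum hvle
      _ = K * Nv := by rw [sum_const, nsmul_eq_mul]
  have hsum_Ru : ∑ a ∈ Ru, u a ≤ K * (Nu / 2 ^ J) := by
    calc ∑ a ∈ Ru, u a ≤ ∑ a ∈ Ru, Nu / 2 ^ J := sum_le_sum fun a ha => (mem_filter.1 ha).2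
      _ = Ru.card * (Nu / 2 ^ J) := by rw [sum_const, nsmul_eq_mul]
      _ ≤ K * (Nu / 2 ^ J) := by
          gcongr
          exact_mod_cast card_le_card (filter_subset _ S)
  have hsum_Rv : ∑ b ∈ Rv, v b ≤ K * (Nv / 2 ^ J) := by
    calc ∑ b ∈ Rv, v b ≤ ∑ b ∈ Rv, Nv / 2 ^ J := sum_le_sum fun b hb => (mem_filter.1 hb).2
      _ = Rv.card * (Nv / 2 ^ J) := by rw [sum_const, nsmul_eq_mul]
      _ ≤ K * (Nv / 2 ^ J) := by
          gcongr
          exact_mod_cast card_le_card (filter_subset _ S)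
  have hsum_Hv : ∑ b ∈ Hv, v b ≤ K * Nv :=
    (sum_le_sum_of_subset_of_nonneg (filter_subset _ S) fun b hb _ => hv b hb).trans hsum_v
  have hKK : (K : ℝ) * (K / 2 ^ J) ≤ 1 := by
    rw [← mul_div_assoc, div_le_one h2J]; nlinarith [hKJ]
  -- T1 := Σ_{a∈S} Σ_{b∈Rv}
  have hT1 : |∑ a ∈ S, ∑ b ∈ Rv, M a b * u a * v b| ≤ Nu * Nv := by
    refine (abs_bilin_le_sum_mul_sum M hM S Rv u v hu fun b hb => hv b (mem_filter.1 hb).1).trans ?_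
    calc (∑ a ∈ S, u a) * ∑ b ∈ Rv, v b ≤ (K * Nu) * (K * (Nv / 2 ^ J)) :=
          mul_le_mul hsum_u hsum_Rv (sum_nonneg fun b hb => hv b (mem_filter.1 hb).1)
            (mul_nonneg (Nat.cast_nonneg _) hNu0)
      _ = (K * (K / 2 ^ J)) * (Nu * Nv) := by ring
      _ ≤ 1 * (Nu * Nv) := by gcongr
      _ = Nu * Nv := one_mul _
  -- T21 := Σ_{a∈Ru} Σ_{b∈Hv}
  have hT21 : |∑ a ∈ Ru, ∑ b ∈ Hv, M a b * u a * v b| ≤ Nu * Nv := by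
    refine (abs_bilin_le_sum_mul_sum M hM Ru Hv u v (fun a ha => hu a (mem_filter.1 ha).1)
      fun b hb => hv b (mem_filter.1 hb).1).trans ?_
    calc (∑ a ∈ Ru, u a) * ∑ b ∈ Hv, v b ≤ (K * (Nu / 2 ^ J)) * (K * Nv) :=
          mul_le_mul hsum_Ru hsum_Hv (sum_nonneg fun b hb => hv b (mem_filter.1 hb).1)
            (mul_nonneg (Nat.cast_nonneg _) (div_nonneg hNu0 h2J.le))
      _ = (K * (K / 2 ^ J)) * (Nu * Nv) := by ring
      _ ≤ 1 * (Nu * Nv) := by gcongr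
      _ = Nu * Nv := one_mul _
  -- T22 := Σ_{a∈Hu} Σ_{b∈Hv}, decomposed into classes
  set Cu : ℕ → Finset ι := fun j => S.filter (fun a => Nu / 2 ^ (j + 1) < u a ∧ u a ≤ Nu / 2 ^ j) with hCu
  set Cv : ℕ → Finset ι := fun k => S.filter (fun b => Nv / 2 ^ (k + 1) < v b ∧ v b ≤ Nv / 2 ^ k) with hCv
  have hT22eq : ∑ a ∈ Hu, ∑ b ∈ Hv, M a b * u a * v b =
      ∑ j ∈ range J, ∑ k ∈ range J, ∑ a ∈ Cu j, ∑ b ∈ Cv k, M a b * u a * v b := by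
    rw [hHu, sum_filter_gt_eq_sum_classes S u Nu hNupos hule J]
    refine sum_congr rfl fun j _ => ?_
    have hinner : ∀ a : ι, ∑ b ∈ Hv, M a b * u a * v b =
        ∑ k ∈ range J, ∑ b ∈ Cv k, M a b * u a * v b := by
      intro a
      rw [hHv, sum_filter_gt_eq_sum_classes S v Nv hNvpos hvle J]
    simp_rw [hinner]
    rw [sum_comm]
  have hblock : ∀ j k : ℕ, |∑ a ∈ Cu j, ∑ b ∈ Cv k, M a b * u a * v b| ≤
      θ * ((Nu / 2 ^ j) * Real.sqrt (Cu j).card) * ((Nv / 2 ^ k) * Real.sqrt (Cv k).card) := by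
    intro j k
    have hcj : 0 < Nu / 2 ^ j := div_pos hNupos (by positivity)
    have hck : 0 < Nv / 2 ^ k := div_pos hNvpos (by positivity)
    have hresc : ∑ a ∈ Cu j, ∑ b ∈ Cv k, M a b * u a * v b = (Nu / 2 ^ j) * (Nv / 2 ^ k) *
        ∑ a ∈ Cu j, ∑ b ∈ Cv k, M a b * (u a / (Nu / 2 ^ j)) * (v b / (Nv / 2 ^ k)) := by
      rw [mul_sum]
      refine sum_congr rfl fun a _ => ?_
      rw [mul_sum]
      refine sum_congr rfl fun b _ => ?_
      field_simp
    have hbox := abs_bilin_weighted_le_of_flat S M θ hθ hflat (Cu j) (Cv k) (filter_subset _ S)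
      (filter_subset _ S) (fun a => u a / (Nu / 2 ^ j)) (fun b => v b / (Nv / 2 ^ k))
      (fun a ha => div_nonneg (hu a (mem_filter.1 ha).1) hcj.le)
      (fun a ha => (div_le_one hcj).2 (mem_filter.1 ha).2.2)
      (fun b hb => div_nonneg (hv b (mem_filter.1 hb).1) hck.le)
      (fun b hb => (div_le_one hck).2 (mem_filter.1 hb).2.2)
    rw [hresc, abs_mul, abs_of_pos (mul_pos hcj hck)]
    calc Nu / 2 ^ j * (Nv / 2 ^ k) *
          |∑ a ∈ Cu j, ∑ b ∈ Cv k, M a b * (u a / (Nu / 2 ^ j)) * (v b / (Nv / 2 ^ k))|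
        ≤ Nu / 2 ^ j * (Nv / 2 ^ k) * (θ * (Real.sqrt (Cu j).card * Real.sqrt (Cv k).card)) :=
          mul_le_mul_of_nonneg_left hbox (mul_pos hcj hck).le
      _ = θ * ((Nu / 2 ^ j) * Real.sqrt (Cu j).card) * ((Nv / 2 ^ k) * Real.sqrt (Cv k).card) := by
          ring
  have hXu : ∑ j ∈ range J, (Nu / 2 ^ j) * Real.sqrt (Cu j).card ≤ 2 * Real.sqrt J * Nu :=
    sum_classWeight_sqrt_card_le S u Nu hNupos hule J
  have hXv : ∑ k ∈ range J, (Nv / 2 ^ k) * Real.sqrt (Cv k).card ≤ 2 * Real.sqrt J * Nv :=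
    sum_classWeight_sqrt_card_le S v Nv hNvpos hvle J
  have hXv0 : 0 ≤ ∑ k ∈ range J, (Nv / 2 ^ k) * Real.sqrt (Cv k).card :=
    sum_nonneg fun k _ => mul_nonneg (div_nonneg hNv0 (by positivity)) (Real.sqrt_nonneg _)
  have hXu0 : 0 ≤ ∑ j ∈ range J, (Nu / 2 ^ j) * Real.sqrt (Cu j).card :=
    sum_nonneg fun j _ => mul_nonneg (div_nonneg hNu0 (by positivity)) (Real.sqrt_nonneg _)
  have hT22 : |∑ a ∈ Hu, ∑ b ∈ Hv, M a b * u a * v b| ≤ 4 * θ * J * (Nu * Nv) := by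
    rw [hT22eq]
    calc |∑ j ∈ range J, ∑ k ∈ range J, ∑ a ∈ Cu j, ∑ b ∈ Cv k, M a b * u a * v b|
        ≤ ∑ j ∈ range J, ∑ k ∈ range J, |∑ a ∈ Cu j, ∑ b ∈ Cv k, M a b * u a * v b| :=
          (abs_sum_le_sum_abs _ _).trans (sum_le_sum fun j _ => abs_sum_le_sum_abs _ _)
      _ ≤ ∑ j ∈ range J, ∑ k ∈ range J,
            θ * ((Nu / 2 ^ j) * Real.sqrt (Cu j).card) * ((Nv / 2 ^ k) * Real.sqrt (Cv k).card) :=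
          sum_le_sum fun j _ => sum_le_sum fun k _ => hblock j k
      _ = θ * ((∑ j ∈ range J, (Nu / 2 ^ j) * Real.sqrt (Cu j).card) *
            (∑ k ∈ range J, (Nv / 2 ^ k) * Real.sqrt (Cv k).card)) := by
          rw [sum_mul_sum, mul_sum]
          refine sum_congr rfl fun j _ => ?_
          rw [mul_sum]
          refine sum_congr rfl fun k _ => ?_
          ring
      _ ≤ θ * ((2 * Real.sqrt J * Nu) * (2 * Real.sqrt J * Nv)) :=
          mul_le_mul_of_nonneg_left (mul_le_mul hXu hXv hXv0 (by positivity)) hθ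
      _ = 4 * θ * (Real.sqrt J * Real.sqrt J) * (Nu * Nv) := by ring
      _ = 4 * θ * J * (Nu * Nv) := by rw [Real.mul_self_sqrt (Nat.cast_nonneg _)]
  -- assemble
  have htot : ∑ a ∈ S, ∑ b ∈ S, M a b * u a * v b =
      ∑ a ∈ S, ∑ b ∈ Rv, M a b * u a * v b + (∑ a ∈ Ru, ∑ b ∈ Hv, M a b * u a * v b +
        ∑ a ∈ Hu, ∑ b ∈ Hv, M a b * u a * v b) := by
    rw [← hsplit_u (fun a => ∑ b ∈ Hv, M a b * u a * v b), ← sum_add_distrib]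
    exact sum_congr rfl fun a _ => hsplit_v _
  rw [htot]
  have hJcast : (J : ℝ) = 2 * Nat.log 2 K + 2 := by rw [hJ]; push_cast; ring
  calc |∑ a ∈ S, ∑ b ∈ Rv, M a b * u a * v b + (∑ a ∈ Ru, ∑ b ∈ Hv, M a b * u a * v b +
          ∑ a ∈ Hu, ∑ b ∈ Hv, M a b * u a * v b)|
      ≤ |∑ a ∈ S, ∑ b ∈ Rv, M a b * u a * v b| + (|∑ a ∈ Ru, ∑ b ∈ Hv, M a b * u a * v b| +
          |∑ a ∈ Hu, ∑ b ∈ Hv, M a b * u a * v b|) :=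
        (abs_add_le _ _).trans (add_le_add le_rfl (abs_add_le _ _))
    _ ≤ Nu * Nv + (Nu * Nv + 4 * θ * J * (Nu * Nv)) := add_le_add hT1 (add_le_add hT21 hT22)
    _ = (4 * θ * (2 * Nat.log 2 K + 2) + 2) * (Nu * Nv) := by rw [hJcast]; ring

/-- Positive/negative parts: `max(t,0)² + max(−t,0)² = t²`. [folklore] -/
theorem max_zero_sq_add_max_neg_zero_sq (t : ℝ) : max t 0 ^ 2 + max (-t) 0 ^ 2 = t ^ 2 := by
  rcases le_total 0 t with h | h
  · rw [max_eq_left h, max_eq_right (by linarith)]; ring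
  · rw [max_eq_right h, max_eq_left (by linarith)]; ring

/-- For the positive/negative parts `u⁺, u⁻` of a real vector: `‖u⁺‖₂ + ‖u⁻‖₂ ≤ √2 ‖u‖₂`, in the product
form `(‖u⁺‖+‖u⁻‖)(‖v⁺‖+‖v⁻‖) ≤ 2‖u‖‖v‖`. [folklore] -/
theorem posneg_norm_prod_le (S : Finset ι) (u v : ι → ℝ) :
    (Real.sqrt (∑ a ∈ S, max (u a) 0 ^ 2) + Real.sqrt (∑ a ∈ S, max (-u a) 0 ^ 2)) *
        (Real.sqrt (∑ b ∈ S, max (v b) 0 ^ 2) + Real.sqrt (∑ b ∈ S, max (-v b) 0 ^ 2)) ≤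
      2 * (Real.sqrt (∑ a ∈ S, u a ^ 2) * Real.sqrt (∑ b ∈ S, v b ^ 2)) := by
  have key : ∀ f : ι → ℝ,
      (Real.sqrt (∑ a ∈ S, max (f a) 0 ^ 2) + Real.sqrt (∑ a ∈ S, max (-f a) 0 ^ 2)) ^ 2 ≤
        2 * Real.sqrt (∑ a ∈ S, f a ^ 2) ^ 2 := by
    intro f
    have hp : 0 ≤ ∑ a ∈ S, max (f a) 0 ^ 2 := sum_nonneg fun a _ => sq_nonneg _
    have hm : 0 ≤ ∑ a ∈ S, max (-f a) 0 ^ 2 := sum_nonneg fun a _ => sq_nonneg _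
    have hf : 0 ≤ ∑ a ∈ S, f a ^ 2 := sum_nonneg fun a _ => sq_nonneg _
    have hsum : (∑ a ∈ S, max (f a) 0 ^ 2) + ∑ a ∈ S, max (-f a) 0 ^ 2 = ∑ a ∈ S, f a ^ 2 := by
      rw [← sum_add_distrib]
      exact sum_congr rfl fun a _ => max_zero_sq_add_max_neg_zero_sq (f a)
    rw [add_sq, Real.sq_sqrt hp, Real.sq_sqrt hm, Real.sq_sqrt hf, ← hsum]
    nlinarith [two_mul_le_add_sq (Real.sqrt (∑ a ∈ S, max (f a) 0 ^ 2))
      (Real.sqrt (∑ a ∈ S, max (-f a) 0 ^ 2)), Real.sq_sqrt hp, Real.sq_sqrt hm]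
  have hU := key u
  have hV := key v
  have hA : 0 ≤ Real.sqrt (∑ a ∈ S, max (u a) 0 ^ 2) + Real.sqrt (∑ a ∈ S, max (-u a) 0 ^ 2) := by
    positivity
  have hB : 0 ≤ Real.sqrt (∑ b ∈ S, max (v b) 0 ^ 2) + Real.sqrt (∑ b ∈ S, max (-v b) 0 ^ 2) := by
    positivity
  have hC : 0 ≤ 2 * (Real.sqrt (∑ a ∈ S, u a ^ 2) * Real.sqrt (∑ b ∈ S, v b ^ 2)) := by positivity
  have hsq : ((Real.sqrt (∑ a ∈ S, max (u a) 0 ^ 2) + Real.sqrt (∑ a ∈ S, max (-u a) 0 ^ 2)) *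
        (Real.sqrt (∑ b ∈ S, max (v b) 0 ^ 2) + Real.sqrt (∑ b ∈ S, max (-v b) 0 ^ 2))) ^ 2 ≤
      (2 * (Real.sqrt (∑ a ∈ S, u a ^ 2) * Real.sqrt (∑ b ∈ S, v b ^ 2))) ^ 2 := by
    rw [mul_pow]
    calc _ ≤ (2 * Real.sqrt (∑ a ∈ S, u a ^ 2) ^ 2) * (2 * Real.sqrt (∑ b ∈ S, v b ^ 2) ^ 2) :=
          mul_le_mul hU hV (sq_nonneg _) (by positivity)
      _ = _ := by ring
  exact (pow_le_pow_iff_left₀ (mul_nonneg hA hB) hC two_ne_zero).1 hsq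

/-- **Flat ⇒ general, real weights** (signs cost a factor `2`):
`|Σ_{a,b∈S} M_{ab} u_a v_b| ≤ 2(4θ(2·log₂#S + 2) + 2) ‖u‖₂ ‖v‖₂`. [folklore] -/
theorem abs_bilin_le_of_flat_real (S : Finset ι) (M : ι → ι → ℝ) (hM : ∀ a b, |M a b| ≤ 1)
    (θ : ℝ) (hθ : 0 ≤ θ)
    (hflat : ∀ A ⊆ S, ∀ B ⊆ S,
      |∑ a ∈ A, ∑ b ∈ B, M a b| ≤ θ * (Real.sqrt A.card * Real.sqrt B.card))
    (u v : ι → ℝ) :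
    |∑ a ∈ S, ∑ b ∈ S, M a b * u a * v b| ≤
      2 * (4 * θ * (2 * Nat.log 2 S.card + 2) + 2) *
        (Real.sqrt (∑ a ∈ S, u a ^ 2) * Real.sqrt (∑ b ∈ S, v b ^ 2)) := by
  set Λ : ℝ := 4 * θ * (2 * Nat.log 2 S.card + 2) + 2 with hΛ
  have hΛ0 : 0 ≤ Λ := by positivity
  have hnn := fun (f : ι → ℝ) (a : ι) (_ : a ∈ S) => le_max_right (f a) 0
  -- the four nonnegative pieces
  have hpp := abs_bilin_le_of_flat_nonneg S M hM θ hθ hflat (fun a => max (u a) 0)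
    (fun b => max (v b) 0) (hnn u) (hnn v)
  have hpm := abs_bilin_le_of_flat_nonneg S M hM θ hθ hflat (fun a => max (u a) 0)
    (fun b => max (-v b) 0) (hnn u) (hnn fun b => -v b)
  have hmp := abs_bilin_le_of_flat_nonneg S M hM θ hθ hflat (fun a => max (-u a) 0)
    (fun b => max (v b) 0) (hnn fun a => -u a) (hnn v)
  have hmm := abs_bilin_le_of_flat_nonneg S M hM θ hθ hflat (fun a => max (-u a) 0)
    (fun b => max (-v b) 0) (hnn fun a => -u a) (hnn fun b => -v b)
  have hexp : ∑ a ∈ S, ∑ b ∈ S, M a b * u a * v b =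
      ∑ a ∈ S, ∑ b ∈ S, M a b * max (u a) 0 * max (v b) 0 -
        ∑ a ∈ S, ∑ b ∈ S, M a b * max (u a) 0 * max (-v b) 0 -
        ∑ a ∈ S, ∑ b ∈ S, M a b * max (-u a) 0 * max (v b) 0 +
        ∑ a ∈ S, ∑ b ∈ S, M a b * max (-u a) 0 * max (-v b) 0 := by
    rw [← sum_sub_distrib, ← sum_sub_distrib, ← sum_add_distrib]
    refine sum_congr rfl fun a _ => ?_
    rw [← sum_sub_distrib, ← sum_sub_distrib, ← sum_add_distrib]
    refine sum_congr rfl fun b _ => ?_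
    have hu' : u a = max (u a) 0 - max (-u a) 0 := (max_zero_sub_max_neg_zero_eq_self (u a)).symm
    have hv' : v b = max (v b) 0 - max (-v b) 0 := (max_zero_sub_max_neg_zero_eq_self (v b)).symm
    generalize max (u a) 0 = P at hu' ⊢
    generalize max (-u a) 0 = P' at hu' ⊢
    generalize max (v b) 0 = Q at hv' ⊢
    generalize max (-v b) 0 = Q' at hv' ⊢
    rw [hu', hv']
    ring
  rw [hexp]
  have hprod := posneg_norm_prod_le S u v
  calc |∑ a ∈ S, ∑ b ∈ S, M a b * max (u a) 0 * max (v b) 0 -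
        ∑ a ∈ S, ∑ b ∈ S, M a b * max (u a) 0 * max (-v b) 0 -
        ∑ a ∈ S, ∑ b ∈ S, M a b * max (-u a) 0 * max (v b) 0 +
        ∑ a ∈ S, ∑ b ∈ S, M a b * max (-u a) 0 * max (-v b) 0|
      ≤ |∑ a ∈ S, ∑ b ∈ S, M a b * max (u a) 0 * max (v b) 0| +
        |∑ a ∈ S, ∑ b ∈ S, M a b * max (u a) 0 * max (-v b) 0| +
        |∑ a ∈ S, ∑ b ∈ S, M a b * max (-u a) 0 * max (v b) 0| +
        |∑ a ∈ S, ∑ b ∈ S, M a b * max (-u a) 0 * max (-v b) 0| := by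
          refine (abs_add_le _ _).trans (add_le_add ((abs_sub _ _).trans (add_le_add
            ((abs_sub _ _).trans le_rfl) le_rfl)) le_rfl)
    _ ≤ Λ * ((Real.sqrt (∑ a ∈ S, max (u a) 0 ^ 2) + Real.sqrt (∑ a ∈ S, max (-u a) 0 ^ 2)) *
        (Real.sqrt (∑ b ∈ S, max (v b) 0 ^ 2) + Real.sqrt (∑ b ∈ S, max (-v b) 0 ^ 2))) := by
          rw [hΛ] at hΛ0 ⊢
          nlinarith [hpp, hpm, hmp, hmm]
    _ ≤ Λ * (2 * (Real.sqrt (∑ a ∈ S, u a ^ 2) * Real.sqrt (∑ b ∈ S, v b ^ 2))) :=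
          mul_le_mul_of_nonneg_left hprod hΛ0
    _ = 2 * Λ * (Real.sqrt (∑ a ∈ S, u a ^ 2) * Real.sqrt (∑ b ∈ S, v b ^ 2)) := by ring

/-- **Flat ⇒ general, complex weights (the flat-RIP lemma, quadratic-form format).**  If
`|M_{ab}| ≤ 1` and `|Σ_{a∈A,b∈B} M_{ab}| ≤ θ √#A √#B` for all `A, B ⊆ S` (`θ ≥ 0`), then for every
`w : ι → ℂ`: `|Σ_{a,b∈S} M_{ab} w_a w_b| ≤ (16 θ (2·log₂#S + 2) + 8) · Σ_{a∈S} |w_a|²`. [folklore] -/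
theorem norm_cplxForm_le_of_flat (S : Finset ι) (M : ι → ι → ℝ) (hM : ∀ a b, |M a b| ≤ 1)
    (θ : ℝ) (hθ : 0 ≤ θ)
    (hflat : ∀ A ⊆ S, ∀ B ⊆ S,
      |∑ a ∈ A, ∑ b ∈ B, M a b| ≤ θ * (Real.sqrt A.card * Real.sqrt B.card))
    (w : ι → ℂ) :
    ‖∑ a ∈ S, ∑ b ∈ S, (M a b : ℂ) * w a * w b‖ ≤
      (16 * θ * (2 * Nat.log 2 S.card + 2) + 8) * ∑ a ∈ S, ‖w a‖ ^ 2 := by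
  set Λ : ℝ := 4 * θ * (2 * Nat.log 2 S.card + 2) + 2 with hΛ
  have hΛ0 : 0 ≤ Λ := by positivity
  set x : ι → ℝ := fun a => (w a).re with hx
  set y : ι → ℝ := fun a => (w a).im with hy
  have hre : (∑ a ∈ S, ∑ b ∈ S, (M a b : ℂ) * w a * w b).re =
      ∑ a ∈ S, ∑ b ∈ S, M a b * x a * x b - ∑ a ∈ S, ∑ b ∈ S, M a b * y a * y b := by
    rw [Complex.re_sum, ← sum_sub_distrib]
    refine sum_congr rfl fun a _ => ?_
    rw [Complex.re_sum, ← sum_sub_distrib]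
    refine sum_congr rfl fun b _ => ?_
    simp only [Complex.mul_re, Complex.mul_im, Complex.ofReal_re, Complex.ofReal_im, hx, hy]
    ring
  have him : (∑ a ∈ S, ∑ b ∈ S, (M a b : ℂ) * w a * w b).im =
      ∑ a ∈ S, ∑ b ∈ S, M a b * x a * y b + ∑ a ∈ S, ∑ b ∈ S, M a b * y a * x b := by
    rw [Complex.im_sum, ← sum_add_distrib]
    refine sum_congr rfl fun a _ => ?_
    rw [Complex.im_sum, ← sum_add_distrib]
    refine sum_congr rfl fun b _ => ?_
    simp only [Complex.mul_im, Complex.mul_re, Complex.ofReal_re, Complex.ofReal_im, hx, hy]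
    ring
  have hxx := abs_bilin_le_of_flat_real S M hM θ hθ hflat x x
  have hyy := abs_bilin_le_of_flat_real S M hM θ hθ hflat y y
  have hxy := abs_bilin_le_of_flat_real S M hM θ hθ hflat x y
  have hyx := abs_bilin_le_of_flat_real S M hM θ hθ hflat y x
  have hnorm : ∑ a ∈ S, ‖w a‖ ^ 2 = (∑ a ∈ S, x a ^ 2) + ∑ a ∈ S, y a ^ 2 := by
    rw [← sum_add_distrib]
    refine sum_congr rfl fun a _ => ?_
    rw [Complex.sq_norm, Complex.normSq_apply, hx, hy]
    ring
  have hX : 0 ≤ ∑ a ∈ S, x a ^ 2 := sum_nonneg fun a _ => sq_nonneg _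
  have hY : 0 ≤ ∑ a ∈ S, y a ^ 2 := sum_nonneg fun a _ => sq_nonneg _
  set Nx := Real.sqrt (∑ a ∈ S, x a ^ 2) with hNx
  set Ny := Real.sqrt (∑ a ∈ S, y a ^ 2) with hNy
  have hNx2 : Nx ^ 2 = ∑ a ∈ S, x a ^ 2 := Real.sq_sqrt hX
  have hNy2 : Ny ^ 2 = ∑ a ∈ S, y a ^ 2 := Real.sq_sqrt hY
  have hamgm := two_mul_le_add_sq Nx Ny
  calc ‖∑ a ∈ S, ∑ b ∈ S, (M a b : ℂ) * w a * w b‖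
      ≤ |(∑ a ∈ S, ∑ b ∈ S, (M a b : ℂ) * w a * w b).re| +
          |(∑ a ∈ S, ∑ b ∈ S, (M a b : ℂ) * w a * w b).im| := Complex.norm_le_abs_re_add_abs_im _
    _ ≤ (|∑ a ∈ S, ∑ b ∈ S, M a b * x a * x b| + |∑ a ∈ S, ∑ b ∈ S, M a b * y a * y b|) +
          (|∑ a ∈ S, ∑ b ∈ S, M a b * x a * y b| + |∑ a ∈ S, ∑ b ∈ S, M a b * y a * x b|) := by
          rw [hre, him]
          exact add_le_add (abs_sub _ _) (abs_add_le _ _)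
    _ ≤ 2 * Λ * (Nx * Nx) + 2 * Λ * (Ny * Ny) + (2 * Λ * (Nx * Ny) + 2 * Λ * (Ny * Nx)) := by
          rw [hΛ] at hΛ0 ⊢
          linarith [hxx, hyy, hxy, hyx]
    _ ≤ 4 * Λ * (Nx ^ 2 + Ny ^ 2) := by nlinarith [hamgm, hΛ0]
    _ = (16 * θ * (2 * Nat.log 2 S.card + 2) + 8) * ∑ a ∈ S, ‖w a‖ ^ 2 := by
          rw [hnorm, ← hNx2, ← hNy2, hΛ]; ring

end FlatToGeneral

end

end Summit.ValiantsHypothesis.ValiantsHypothesis.Theorems.FeketeSOSHardPaleyRIP
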